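import Summits.AtomisticToContinuum.HydrodynamicLimit.Theses.LambertianContactSwap
import Literature.Analysis.FluidPDE.HardSphereFlowMeasurable
import Literature.MathematicalPhysics.KineticTheory.HardSphereEulerProofs
import HarnessLib

/-!
# Stub `stub_abstract` of the line `Sketch` of the crux `ContactAngleEquidistribution`
# (stmt-AtomisticToContinuum-12097, route LambertianContactSwap)

Registered stub of the lead skeleton `Cruxes/ContactAngleEquidistribution/Lines/Sketch.lean`
(namespace `…Cruxes.ContactAngleEquidistribution.Sketch`); the signature below is VERBATIM the
registered one.

Mathematics (pure measure theory, the bookkeeping of a large-deviation transfer). Fix `ε > 0`.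
From `E_μ W ≤ K` (WLOG `K ≥ 0`) choose `V := max 1 (8K/ε)`, so that `|∫ R dμ| ≤ (2/V) K ≤ ε/4`;
`|∫ B dμ| < ε/4` eventually by the near-field hypothesis. For the isolated part, with `η := ε/4` and
`S := {η < |A|}`: `|∫ A dμ| ≤ η + ∫_S |A| dμ ≤ η + 2V² ∫_S X dμ ≤ η + 2V² e^{C(N+1)} ∫_S X dν`
(domination `μ_N ≤ e^{C(N+1)} ν_N`) `≤ η + 2V² e^{C(N+1)} (∫ X² dν)^{1/2} ν(S)^{1/2}`
(Cauchy–Schwarz) `≤ η + 2V² √K₂ e^{C(N+1)} e^{-(C+1)(N+1)} = η + 2V² √K₂ e^{-(N+1)} < ε/2`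
eventually, using the superexponential concentration hypothesis at level `η` with rate
`M := 2C + 2`. Summing, `|∫ D dμ| < ε` eventually.
-/

noncomputable section

open MeasureTheory Filter Set Topology ProbabilityTheory
open scoped ENNReal BigOperators Classical

namespace Summit.AtomisticToContinuum.HydrodynamicLimit.Theorems.ContactAngleEquidistributionSketch

open Literature.Analysis.FluidPDE Literature.MathematicalPhysics.KineticTheory
open Summit.AtomisticToContinuum.HydrodynamicLimit.Theses.LambertianContactSwap

variable {Ω : Type*} [MeasurableSpace Ω]

/-! ### Integrability and first-moment bounds from `|f| ≤ c W`, `∫⁻ W ≤ K` -/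

/-- A nonnegative measurable `W` with `∫⁻ ofReal W ≤ ofReal K` is integrable. [folklore] -/
theorem integrable_of_lintegral_ofReal_le {μ : Measure Ω} {W : Ω → ℝ} {K : ℝ}
    (hW : Measurable W) (hW0 : ∀ z, 0 ≤ W z)
    (hWK : ∫⁻ z, ENNReal.ofReal (W z) ∂μ ≤ ENNReal.ofReal K) : Integrable W μ := by
  refine ⟨hW.aestronglyMeasurable, ?_⟩
  rw [hasFiniteIntegral_iff_ofReal (Eventually.of_forall hW0)]
  exact hWK.trans_lt ENNReal.ofReal_lt_top

/-- A measurable `f` with `|f| ≤ c W`, `W` as above, is integrable. [folklore] -/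
theorem integrable_of_abs_le_mul {μ : Measure Ω} {f W : Ω → ℝ} {c K : ℝ}
    (hf : Measurable f) (hW : Measurable W) (hW0 : ∀ z, 0 ≤ W z)
    (hWK : ∫⁻ z, ENNReal.ofReal (W z) ∂μ ≤ ENNReal.ofReal K) (hfW : ∀ z, |f z| ≤ c * W z) :
    Integrable f μ :=
  ((integrable_of_lintegral_ofReal_le hW hW0 hWK).const_mul c).mono' hf.aestronglyMeasurable
    (Eventually.of_forall fun z => by
      rw [Real.norm_eq_abs]
      exact hfW z)

/-- `∫ W ≤ K` from `∫⁻ ofReal W ≤ ofReal K` (`W ≥ 0`, `K ≥ 0`). [folklore] -/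
theorem integral_le_of_lintegral_ofReal_le {μ : Measure Ω} {W : Ω → ℝ} {K : ℝ}
    (hW : Measurable W) (hW0 : ∀ z, 0 ≤ W z) (hK : 0 ≤ K)
    (hWK : ∫⁻ z, ENNReal.ofReal (W z) ∂μ ≤ ENNReal.ofReal K) : ∫ z, W z ∂μ ≤ K := by
  rw [integral_eq_lintegral_of_nonneg_ae (Eventually.of_forall hW0) hW.aestronglyMeasurable]
  exact ENNReal.toReal_le_of_le_ofReal hK hWK

/-- `|∫ f| ≤ c K` when `|f| ≤ c W` and `∫⁻ ofReal W ≤ ofReal K` (`c, K ≥ 0`). [folklore] -/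
theorem abs_integral_le_mul_of_abs_le {μ : Measure Ω} {f W : Ω → ℝ} {c K : ℝ}
    (hf : Measurable f) (hW : Measurable W) (hW0 : ∀ z, 0 ≤ W z) (hc : 0 ≤ c) (hK : 0 ≤ K)
    (hWK : ∫⁻ z, ENNReal.ofReal (W z) ∂μ ≤ ENNReal.ofReal K) (hfW : ∀ z, |f z| ≤ c * W z) :
    |∫ z, f z ∂μ| ≤ c * K := by
  have hfi : Integrable f μ := integrable_of_abs_le_mul hf hW hW0 hWK hfW
  have hWi : Integrable W μ := integrable_of_lintegral_ofReal_le hW hW0 hWK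
  calc |∫ z, f z ∂μ| ≤ ∫ z, |f z| ∂μ := abs_integral_le_integral_abs
    _ ≤ ∫ z, c * W z ∂μ := integral_mono hfi.abs (hWi.const_mul c) hfW
    _ = c * ∫ z, W z ∂μ := integral_const_mul c _
    _ ≤ c * K :=
        mul_le_mul_of_nonneg_left (integral_le_of_lintegral_ofReal_le hW hW0 hK hWK) hc

/-! ### The level-set split `|∫ f| ≤ η + ∫_{η < |f|} |f|` -/

/-- For a probability measure and `η ≥ 0`: `|∫ f| ≤ η + ∫_{η < |f|} |f|`, the second term written
as a Lebesgue integral. [folklore] -/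
theorem abs_integral_le_add_toReal_setLIntegral {μ : Measure Ω} [IsProbabilityMeasure μ]
    {f : Ω → ℝ} (hf : Measurable f) (hfi : Integrable f μ) {η : ℝ} (hη : 0 ≤ η) :
    |∫ z, f z ∂μ| ≤ η + (∫⁻ z in {z | η < |f z|}, ENNReal.ofReal |f z| ∂μ).toReal := by
  have hS : MeasurableSet {z | η < |f z|} := measurableSet_lt measurable_const hf.abs
  calc |∫ z, f z ∂μ| ≤ ∫ z, |f z| ∂μ := abs_integral_le_integral_abs
    _ ≤ ∫ z, (η + {z | η < |f z|}.indicator (fun z => |f z|) z) ∂μ := by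
        refine integral_mono hfi.abs ((integrable_const η).add (hfi.abs.indicator hS)) fun z => ?_
        by_cases hz : η < |f z|
        · have hz' : z ∈ {z | η < |f z|} := hz
          rw [Set.indicator_of_mem hz']
          linarith
        · have hz' : z ∉ {z | η < |f z|} := hz
          rw [Set.indicator_of_notMem hz', add_zero]
          exact not_lt.1 hz
    _ = η + ∫ z in {z | η < |f z|}, |f z| ∂μ := by
        rw [integral_add (integrable_const η) (hfi.abs.indicator hS), integral_indicator hS,
          integral_const, probReal_univ, one_smul]
    _ = η + (∫⁻ z in {z | η < |f z|}, ENNReal.ofReal |f z| ∂μ).toReal := by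
        rw [integral_eq_lintegral_of_nonneg_ae (Eventually.of_forall fun z => abs_nonneg (f z))
          hf.abs.aestronglyMeasurable]

/-! ### Domination and Cauchy–Schwarz on the level set -/

/-- `μ ≤ E • ν` transfers set Lebesgue integrals: `∫⁻_S g dμ ≤ E ∫⁻_S g dν`. [folklore] -/
theorem setLIntegral_le_mul_of_le_smul {μ ν : Measure Ω} {E : ℝ≥0∞} (h : μ ≤ E • ν)
    (g : Ω → ℝ≥0∞) (S : Set Ω) : ∫⁻ z in S, g z ∂μ ≤ E * ∫⁻ z in S, g z ∂ν :=
  calc ∫⁻ z in S, g z ∂μ ≤ ∫⁻ z in S, g z ∂(E • ν) :=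
        lintegral_mono' (Measure.restrict_mono_measure h S) le_rfl
    _ = E * ∫⁻ z in S, g z ∂ν := by rw [setLIntegral_smul_measure, smul_eq_mul]

/-- Cauchy–Schwarz on a level set: `∫⁻_S X dν ≤ (∫⁻ X² dν)^{1/2} ν(S)^{1/2}` for measurable
`X ≥ 0`. [folklore] -/
theorem setLIntegral_ofReal_le_sqrt {ν : Measure Ω} {X : Ω → ℝ} (hX : Measurable X)
    (hX0 : ∀ z, 0 ≤ X z) (S : Set Ω) :
    ∫⁻ z in S, ENNReal.ofReal (X z) ∂ν ≤
      (∫⁻ z, ENNReal.ofReal (X z ^ 2) ∂ν) ^ (1 / 2 : ℝ) * ν S ^ (1 / 2 : ℝ) := by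
  have h := ENNReal.lintegral_mul_le_Lp_mul_Lq (ν.restrict S) Real.HolderConjugate.two_two
    (f := fun z => ENNReal.ofReal (X z)) (g := fun _ => (1 : ℝ≥0∞))
    hX.ennreal_ofReal.aemeasurable aemeasurable_const
  simp only [Pi.mul_apply, mul_one, ENNReal.one_rpow, setLIntegral_one] at h
  refine h.trans (mul_le_mul_left (ENNReal.rpow_le_rpow ?_ (by norm_num)) _)
  calc ∫⁻ z in S, ENNReal.ofReal (X z) ^ (2 : ℝ) ∂ν
      ≤ ∫⁻ z, ENNReal.ofReal (X z) ^ (2 : ℝ) ∂ν := setLIntegral_le_lintegral _ _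
    _ = ∫⁻ z, ENNReal.ofReal (X z ^ 2) ∂ν := lintegral_congr fun z => by
        rw [ENNReal.ofReal_rpow_of_nonneg (hX0 z) zero_le_two, Real.rpow_two]

/-- The isolated-collision bound for one `N`: if `|a| ≤ c X`, `μ ≤ e^{…} ν =: E • ν`,
`∫⁻ X² dν ≤ K₂` and `ν(S) ≤ m²`, then `∫_S |a| dμ ≤ c E √K₂ m`. [folklore] -/
theorem toReal_setLIntegral_abs_le {μ ν : Measure Ω} {a X : Ω → ℝ} {S : Set Ω}
    {c E K₂ m : ℝ} (hX : Measurable X) (hX0 : ∀ z, 0 ≤ X z) (hc : 0 ≤ c) (hE : 0 ≤ E)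
    (hK₂ : 0 ≤ K₂) (hm : 0 ≤ m) (haX : ∀ z, |a z| ≤ c * X z)
    (hdom : μ ≤ ENNReal.ofReal E • ν)
    (hmom : ∫⁻ z, ENNReal.ofReal (X z ^ 2) ∂ν ≤ ENNReal.ofReal K₂)
    (hS : ν S ≤ ENNReal.ofReal (m ^ 2)) :
    (∫⁻ z in S, ENNReal.ofReal |a z| ∂μ).toReal ≤ c * E * √K₂ * m := by
  refine ENNReal.toReal_le_of_le_ofReal (by positivity) ?_
  calc ∫⁻ z in S, ENNReal.ofReal |a z| ∂μ
      ≤ ∫⁻ z in S, ENNReal.ofReal c * ENNReal.ofReal (X z) ∂μ :=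
        lintegral_mono fun z =>
          (ENNReal.ofReal_le_ofReal (haX z)).trans_eq (ENNReal.ofReal_mul hc)
    _ = ENNReal.ofReal c * ∫⁻ z in S, ENNReal.ofReal (X z) ∂μ :=
        lintegral_const_mul _ hX.ennreal_ofReal
    _ ≤ ENNReal.ofReal c * (ENNReal.ofReal E * ∫⁻ z in S, ENNReal.ofReal (X z) ∂ν) :=
        mul_le_mul_right (setLIntegral_le_mul_of_le_smul hdom _ S) _
    _ ≤ ENNReal.ofReal c * (ENNReal.ofReal E *
          ((∫⁻ z, ENNReal.ofReal (X z ^ 2) ∂ν) ^ (1 / 2 : ℝ) * ν S ^ (1 / 2 : ℝ))) :=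
        mul_le_mul_right (mul_le_mul_right (setLIntegral_ofReal_le_sqrt hX hX0 S) _) _
    _ ≤ ENNReal.ofReal c * (ENNReal.ofReal E *
          (ENNReal.ofReal K₂ ^ (1 / 2 : ℝ) * ENNReal.ofReal (m ^ 2) ^ (1 / 2 : ℝ))) := by
        gcongr
    _ = ENNReal.ofReal (c * E * √K₂ * m) := by
        rw [ENNReal.ofReal_rpow_of_nonneg hK₂ (by norm_num),
          ENNReal.ofReal_rpow_of_nonneg (sq_nonneg m) (by norm_num), ← Real.sqrt_eq_rpow,
          ← Real.sqrt_eq_rpow, Real.sqrt_sq hm, ← ENNReal.ofReal_mul (Real.sqrt_nonneg _),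
          ← ENNReal.ofReal_mul hE, ← ENNReal.ofReal_mul hc]
        congr 1
        ring

/-! ### The registered stub -/

/-- STUB `abstract` of line `Sketch` (crux ContactAngleEquidistribution, stmt-AtomisticToContinuum-12097): the measure-theoretic bookkeeping of the transfer — probability measures `μ_N ≤ e^{C(N+1)} ν_N`, a decomposition `D = A + B + R` with `|A|,|B| ≤ 2W`, `|R| ≤ 2W/V`, `|A| ≤ 2V²X`, `E_μ W ≤ K`, `E_ν X² ≤ K₂(V)`, superexponential `ν`-concentration of `A` at every level, `E_μ B → 0`; then `E_μ D → 0`. [folklore] -/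
theorem stub_abstract {α : ℕ → Type*} [∀ N, MeasurableSpace (α N)]
    (μ ν : (N : ℕ) → Measure (α N)) (hμ : ∀ N, IsProbabilityMeasure (μ N))
    (D W : (N : ℕ) → α N → ℝ) (A B R X : ℝ → (N : ℕ) → α N → ℝ)
    (hD : ∀ V, 0 < V → ∀ N z, D N z = A V N z + B V N z + R V N z)
    (hAm : ∀ V, 0 < V → ∀ N, Measurable (A V N)) (hBm : ∀ V, 0 < V → ∀ N, Measurable (B V N))
    (hRm : ∀ V, 0 < V → ∀ N, Measurable (R V N)) (hXm : ∀ V, 0 < V → ∀ N, Measurable (X V N))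
    (hWm : ∀ N, Measurable (W N)) (hW0 : ∀ N z, 0 ≤ W N z) (hX0 : ∀ V, 0 < V → ∀ N z, 0 ≤ X V N z)
    (hW : ∃ K : ℝ, ∀ N, ∫⁻ z, ENNReal.ofReal (W N z) ∂μ N ≤ ENNReal.ofReal K)
    (hAW : ∀ V, 0 < V → ∀ N z, |A V N z| ≤ 2 * W N z)
    (hBW : ∀ V, 0 < V → ∀ N z, |B V N z| ≤ 2 * W N z)
    (hRW : ∀ V, 0 < V → ∀ N z, |R V N z| ≤ 2 / V * W N z)
    (hAX : ∀ V, 0 < V → ∀ N z, |A V N z| ≤ 2 * V ^ 2 * X V N z)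
    (hdom : ∃ C : ℝ, ∀ N, μ N ≤ ENNReal.ofReal (Real.exp (C * ((N : ℝ) + 1))) • ν N)
    (hmom : ∀ V, 0 < V → ∃ K₂ : ℝ, ∀ N, ∫⁻ z, ENNReal.ofReal (X V N z ^ 2) ∂ν N ≤ ENNReal.ofReal K₂)
    (hcost : ∀ V, 0 < V → ∀ η : ℝ, 0 < η → ∀ M : ℝ, ∀ᶠ N : ℕ in atTop,
      ν N {z | η < |A V N z|} ≤ ENNReal.ofReal (Real.exp (-(M * ((N : ℝ) + 1)))))
    (hnear : ∀ V, 0 < V → Tendsto (fun N => ∫ z, B V N z ∂μ N) atTop (𝓝 0)) :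
    Tendsto (fun N => ∫ z, D N z ∂μ N) atTop (𝓝 0) := by
  rw [Metric.tendsto_nhds]
  intro ε hε
  -- the constants `K ≥ 0`, `C`, `V ≥ max 1 (8K/ε)`, `K₂ ≥ 0`
  obtain ⟨K, hK0, hWK⟩ : ∃ K : ℝ, 0 ≤ K ∧ ∀ N, ∫⁻ z, ENNReal.ofReal (W N z) ∂μ N ≤
      ENNReal.ofReal K := by
    obtain ⟨K, hK⟩ := hW
    exact ⟨max K 0, le_max_right _ _, fun N =>
      (hK N).trans (ENNReal.ofReal_le_ofReal (le_max_left _ _))⟩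
  obtain ⟨C, hC⟩ := hdom
  obtain ⟨V, hV1, hV8⟩ : ∃ V : ℝ, 1 ≤ V ∧ 8 * K / ε ≤ V :=
    ⟨max 1 (8 * K / ε), le_max_left _ _, le_max_right _ _⟩
  have hV : 0 < V := one_pos.trans_le hV1
  have hKV : 2 / V * K ≤ ε / 4 := by
    rw [div_le_iff₀ hε] at hV8
    rw [div_mul_eq_mul_div, div_le_iff₀ hV]
    linarith
  obtain ⟨K₂, hK₂0, hXK⟩ : ∃ K₂ : ℝ, 0 ≤ K₂ ∧ ∀ N, ∫⁻ z, ENNReal.ofReal (X V N z ^ 2) ∂ν N ≤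
      ENNReal.ofReal K₂ := by
    obtain ⟨K₂, hK₂⟩ := hmom V hV
    exact ⟨max K₂ 0, le_max_right _ _, fun N =>
      (hK₂ N).trans (ENNReal.ofReal_le_ofReal (le_max_left _ _))⟩
  have hη : (0 : ℝ) < ε / 4 := by positivity
  -- the three eventualities
  have h1 := hcost V hV (ε / 4) hη (2 * C + 2)
  have h2 : ∀ᶠ N : ℕ in atTop, |∫ z, B V N z ∂μ N| < ε / 4 := by
    filter_upwards [Metric.tendsto_nhds.1 (hnear V hV) (ε / 4) hη] with N hN
    rwa [Real.dist_0_eq_abs] at hN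
  have h3 : ∀ᶠ N : ℕ in atTop, 2 * V ^ 2 * √K₂ * Real.exp (-((N : ℝ) + 1)) < ε / 4 := by
    have ht : Tendsto (fun N : ℕ => 2 * V ^ 2 * √K₂ * Real.exp (-((N : ℝ) + 1))) atTop
        (𝓝 (2 * V ^ 2 * √K₂ * 0)) :=
      (Real.tendsto_exp_neg_atTop_nhds_zero.comp
        (tendsto_atTop_add_const_right atTop (1 : ℝ) tendsto_natCast_atTop_atTop)).const_mul _
    rw [mul_zero] at ht
    exact (tendsto_order.1 ht).2 _ hη
  filter_upwards [h1, h2, h3] with N h1 h2 h3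
  haveI := hμ N
  -- integrability and the split `∫ D = ∫ A + ∫ B + ∫ R`
  have hAi : Integrable (A V N) (μ N) :=
    integrable_of_abs_le_mul (hAm V hV N) (hWm N) (hW0 N) (hWK N) (hAW V hV N)
  have hBi : Integrable (B V N) (μ N) :=
    integrable_of_abs_le_mul (hBm V hV N) (hWm N) (hW0 N) (hWK N) (hBW V hV N)
  have hRi : Integrable (R V N) (μ N) :=
    integrable_of_abs_le_mul (hRm V hV N) (hWm N) (hW0 N) (hWK N) (hRW V hV N)
  have hsplit : ∫ z, D N z ∂μ N =
      (∫ z, A V N z ∂μ N) + (∫ z, B V N z ∂μ N) + ∫ z, R V N z ∂μ N := by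
    simp_rw [hD V hV N]
    rw [integral_add (f := fun z => A V N z + B V N z) (hAi.add hBi) hRi, integral_add hAi hBi]
  -- the fast part
  have hR : |∫ z, R V N z ∂μ N| ≤ ε / 4 :=
    (abs_integral_le_mul_of_abs_le (hRm V hV N) (hWm N) (hW0 N) (by positivity) hK0 (hWK N)
      (hRW V hV N)).trans hKV
  -- the isolated part
  have hA : |∫ z, A V N z ∂μ N| < ε / 2 := by
    have step1 := abs_integral_le_add_toReal_setLIntegral (hAm V hV N) hAi hη.le
    have hmsq : Real.exp (-((2 * C + 2) * ((N : ℝ) + 1))) =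
        Real.exp (-((C + 1) * ((N : ℝ) + 1))) ^ 2 := by
      rw [sq, ← Real.exp_add]
      congr 1
      ring
    rw [hmsq] at h1
    have step2 := toReal_setLIntegral_abs_le (hXm V hV N) (hX0 V hV N)
      (by positivity : (0 : ℝ) ≤ 2 * V ^ 2) (Real.exp_pos _).le hK₂0 (Real.exp_pos _).le
      (hAX V hV N) (hC N) (hXK N) h1
    have step3 : Real.exp (C * ((N : ℝ) + 1)) * Real.exp (-((C + 1) * ((N : ℝ) + 1))) =
        Real.exp (-((N : ℝ) + 1)) := by
      rw [← Real.exp_add]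
      congr 1
      ring
    have step4 : 2 * V ^ 2 * Real.exp (C * ((N : ℝ) + 1)) * √K₂ *
        Real.exp (-((C + 1) * ((N : ℝ) + 1))) = 2 * V ^ 2 * √K₂ * Real.exp (-((N : ℝ) + 1)) := by
      rw [← step3]
      ring
    linarith
  -- summing up
  rw [Real.dist_0_eq_abs, hsplit]
  calc |(∫ z, A V N z ∂μ N) + (∫ z, B V N z ∂μ N) + ∫ z, R V N z ∂μ N|
      ≤ |(∫ z, A V N z ∂μ N) + ∫ z, B V N z ∂μ N| + |∫ z, R V N z ∂μ N| := abs_add_le _ _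
    _ ≤ |∫ z, A V N z ∂μ N| + |∫ z, B V N z ∂μ N| + |∫ z, R V N z ∂μ N| := by
        gcongr
        exact abs_add_le _ _
    _ < ε := by linarith

end Summit.AtomisticToContinuum.HydrodynamicLimit.Theorems.ContactAngleEquidistributionSketch

end
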